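import Summits.CriticalPhenomena.PercolationContinuityZ3.Theorems.PercNearOneGluingNoHeavyLowerTailSahiCombTriWGeneral

/-!
# `TRI_W(a)` in Kleitman–shell normal form, and the self-dual stratum `refl P ⊆ P` for every `a`

Support file of the one-cut programme (crux `NoHeavyLowerTail`, stmt-CriticalPhenomena-4575; cell `prim-masterthm`, seat P5 gen 12;
report `P5-LORENTZIAN-TEST.md` §17; memo `FROM-prim-lf-1-g21-CLOSURE.md` §0(v)/§4 has the same identity in prose, found independently).

For a cube `W = Finset γ` (antipode `refl`), an index cube `X = Finset β` (antipode `x ↦ xᶜ`), a family `P` and two families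
`F, G : Finset β → Finset (Finset γ)`, the one-cube triangle functional `FiveUpSet.triW P F G` of `…SahiCombTriWGeneral`
(the (M⁺⁺-3) coefficient of the triangle class) can be rewritten as

  `triW P F G = kleitmanPart P F G + 2 · Σ_{e ∈ P} shellWeight F G e − Σ_{e ∈ refl P} shellWeight F G e`     (`triW_eq_shell`)

where
* `kleitmanPart P F G = Σ_x [(#(P ∩ F x ∩ G xᶜ) − #(P ∩ F x ∩ refl (G xᶜ))) + (#(P ∩ G x ∩ F xᶜ) − #(P ∩ G x ∩ refl (F xᶜ)))]`
  is a sum of `2·#X` KLEITMAN GAPS, each `≥ 0` when `P, F x, G x` are up-sets (`kleitmanPart_nonneg`, Kleitman's antipodal lemma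
  `card_inter_refl_le` inside the up-set `P ∩ F x`, resp. `P ∩ G x`);
* `shellWeight F G e = #(α_e ∩ β_e) − #(α_e ∩ refl β_e)` with the INDEX PROFILES `α_e = {x | e ∈ F x}`, `β_e = {x | e ∈ G x}` (`idxSet`),
  which are up-sets of the index cube when `F, G` are monotone; so `shellWeight F G e ≥ 0` POINTWISE, again by Kleitman's lemma, now
  in the index cube `Finset β` (`shellWeight_nonneg`).  For `#β = 1` it is the indicator of the shell `(F₁ \ F₀) ∩ (G₁ \ G₀)`; for
  `#β = 2` it takes the values `0, 1, 2` on that shell (lf-1's net multiplicity `c(e) = 1_Sh + ε_F ε_G`).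
Consequences (all unconditional, every `a = #β`, every cube):
* **`triW_ge_shell`** — `triW P F G ≥ 2·Σ_{e∈P} c(e) − Σ_{e∈refl P} c(e)`: the whole difficulty of `TriWIneq` is the deficit of the
  shell weight of `P` against that of its antipodal image;
* **`triW_nonneg_of_refl_subset`** — if `refl P ⊆ P` (the up-set contains its antipodal image; e.g. `P = univ`, or any up-set containing
  every set of size `≥ n/2`), then `0 ≤ triW P F G` for ALL monotone families of up-sets `F, G` and every index cube — a stratum of
  `FiveUpSet.TriWIneq` defined by a condition on `P` alone (the known strata `triW_nonneg_of_pairwise_nested`, thin edge, constrain `F, G`);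
* `triW_univ_nonneg` — the case `P = univ`.
HONEST LABEL: an identity, two Kleitman estimates and an easy stratum; `TriWIneq` (a ≥ 2, general `P`) remains OPEN — by `triW_eq_shell`
it is exactly the statement `Σ_{e ∈ refl P \ P} c(e) ≤ kleitmanPart P F G + 2·Σ_{e ∈ P \ refl P} c(e) + Σ_{e ∈ P ∩ refl P} c(e)`. [this work]
-/

namespace Summit.CriticalPhenomena.PercolationContinuityZ3.Theorems

namespace FiveUpSet

open Finset

variable {β γ : Type} [DecidableEq β] [Fintype β] [DecidableEq γ] [Fintype γ]

/-! ### Index profiles and the shell weight -/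

/-- The index profile of a point `e` under a family `F`: `idxSet F e = {x | e ∈ F x}` (a subset of the index cube). [this work] -/
def idxSet (F : Finset β → Finset (Finset γ)) (e : Finset γ) : Finset (Finset β) :=
  univ.filter (fun x => e ∈ F x)

omit [DecidableEq β] [Fintype γ] in
/-- Membership in the index profile. [this work] -/
@[simp] theorem mem_idxSet (F : Finset β → Finset (Finset γ)) (e : Finset γ) (x : Finset β) :
    x ∈ idxSet F e ↔ e ∈ F x := by
  simp [idxSet]

omit [DecidableEq β] [Fintype γ] in
/-- The index profile of a monotone family is an up-set of the index cube. [this work] -/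
theorem isUpperSet_idxSet {F : Finset β → Finset (Finset γ)} (hFm : Monotone F) (e : Finset γ) :
    IsUpperSet (idxSet F e : Set (Finset β)) := by
  intro x y hxy hx
  rw [mem_coe, mem_idxSet] at hx ⊢
  exact hFm hxy hx

omit [Fintype γ] in
/-- Membership in the antipodal image of an index profile: `x ∈ refl (idxSet G e) ↔ e ∈ G xᶜ`. [this work] -/
@[simp] theorem mem_refl_idxSet (G : Finset β → Finset (Finset γ)) (e : Finset γ) (x : Finset β) :
    x ∈ refl (idxSet G e) ↔ e ∈ G xᶜ := by
  rw [mem_refl, mem_idxSet]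

/-- The SHELL WEIGHT of a point: `shellWeight F G e = #{x | e ∈ F x ∩ G x} − #{x | e ∈ F x ∩ G xᶜ} = #(α_e ∩ β_e) − #(α_e ∩ refl β_e)`.
For `#β = 2` this is lf-1's net multiplicity `c(e) ∈ {0,1,2}` (memo CLOSURE §4). [this work] -/
def shellWeight (F G : Finset β → Finset (Finset γ)) (e : Finset γ) : ℤ :=
  ((idxSet F e ∩ idxSet G e).card : ℤ) - (idxSet F e ∩ refl (idxSet G e)).card

omit [Fintype γ] in
/-- **The shell weight is non-negative** for monotone families: Kleitman's antipodal lemma in the INDEX cube. [this work] -/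
theorem shellWeight_nonneg {F G : Finset β → Finset (Finset γ)} (hFm : Monotone F) (hGm : Monotone G) (e : Finset γ) :
    0 ≤ shellWeight F G e := by
  unfold shellWeight
  have h := card_inter_refl_le (isUpperSet_idxSet hFm e) (isUpperSet_idxSet hGm e)
  omega

/-! ### The Kleitman part -/

/-- The KLEITMAN PART of `triW`: `Σ_x [(#(P ∩ F x ∩ G xᶜ) − #(P ∩ F x ∩ refl (G xᶜ))) + (#(P ∩ G x ∩ F xᶜ) − #(P ∩ G x ∩ refl (F xᶜ)))]`,
a sum of `2·2^a` Kleitman gaps. [this work] -/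
def kleitmanPart (P : Finset (Finset γ)) (F G : Finset β → Finset (Finset γ)) : ℤ :=
  ∑ x : Finset β, ((((P ∩ F x ∩ G xᶜ).card : ℤ) - (P ∩ F x ∩ refl (G xᶜ)).card)
    + (((P ∩ G x ∩ F xᶜ).card : ℤ) - (P ∩ G x ∩ refl (F xᶜ)).card))

/-- **The Kleitman part is non-negative** when `P` and all `F x`, `G x` are up-sets (Kleitman's lemma inside `P ∩ F x` and `P ∩ G x`). [this work] -/
theorem kleitmanPart_nonneg (P : Finset (Finset γ)) (F G : Finset β → Finset (Finset γ))
    (hP : IsUpperSet (P : Set (Finset γ))) (hF : ∀ x, IsUpperSet (F x : Set (Finset γ)))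
    (hG : ∀ x, IsUpperSet (G x : Set (Finset γ))) : 0 ≤ kleitmanPart P F G := by
  unfold kleitmanPart
  refine sum_nonneg fun x _ => ?_
  have hPF : IsUpperSet ((P ∩ F x : Finset (Finset γ)) : Set (Finset γ)) := by
    rw [coe_inter]; exact hP.inter (hF x)
  have hPG : IsUpperSet ((P ∩ G x : Finset (Finset γ)) : Set (Finset γ)) := by
    rw [coe_inter]; exact hP.inter (hG x)
  have h1 := card_inter_refl_le hPF (hG xᶜ)
  have h2 := card_inter_refl_le hPG (hF xᶜ)
  omega

/-! ### Double counting -/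

/-- `refl` is an involution. [this work] -/
theorem refl_refl (𝒜 : Finset (Finset γ)) : refl (refl 𝒜) = 𝒜 := by
  ext s; simp only [mem_refl, compl_compl]

/-- `#(refl P ∩ A ∩ B) = #(P ∩ refl A ∩ refl B)`. [this work] -/
theorem card_refl_inter_inter (P A B : Finset (Finset γ)) :
    (refl P ∩ A ∩ B).card = (P ∩ refl A ∩ refl B).card := by
  rw [← card_refl (refl P ∩ A ∩ B), refl_inter, refl_inter, refl_refl]

omit [Fintype γ] in
/-- Double counting: `Σ_{e ∈ P} #(α_e ∩ β_e) = Σ_x #(P ∩ F x ∩ G x)`. [this work] -/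
theorem sum_card_idxSet_inter (P : Finset (Finset γ)) (F G : Finset β → Finset (Finset γ)) :
    ∑ e ∈ P, ((idxSet F e ∩ idxSet G e).card : ℤ) = ∑ x : Finset β, ((P ∩ F x ∩ G x).card : ℤ) := by
  have h1 : ∀ e, ((idxSet F e ∩ idxSet G e).card : ℤ) = ∑ x : Finset β, (if e ∈ F x ∧ e ∈ G x then (1 : ℤ) else 0) := by
    intro e
    rw [Finset.sum_boole]
    congr 2
    ext x; simp [idxSet]
  have h2 : ∀ x : Finset β, ((P ∩ F x ∩ G x).card : ℤ) = ∑ e ∈ P, (if e ∈ F x ∧ e ∈ G x then (1 : ℤ) else 0) := by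
    intro x
    rw [Finset.sum_boole]
    congr 2
    ext e; simp
  simp only [h1, h2]
  exact Finset.sum_comm

omit [Fintype γ] in
/-- Double counting with the reflected second profile: `Σ_{e ∈ P} #(α_e ∩ refl β_e) = Σ_x #(P ∩ F x ∩ G xᶜ)`. [this work] -/
theorem sum_card_idxSet_inter_refl (P : Finset (Finset γ)) (F G : Finset β → Finset (Finset γ)) :
    ∑ e ∈ P, ((idxSet F e ∩ refl (idxSet G e)).card : ℤ) = ∑ x : Finset β, ((P ∩ F x ∩ G xᶜ).card : ℤ) := by
  have h1 : ∀ e, ((idxSet F e ∩ refl (idxSet G e)).card : ℤ)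
      = ∑ x : Finset β, (if e ∈ F x ∧ e ∈ G xᶜ then (1 : ℤ) else 0) := by
    intro e
    rw [Finset.sum_boole]
    congr 2
    ext x; simp [idxSet, mem_refl]
  have h2 : ∀ x : Finset β, ((P ∩ F x ∩ G xᶜ).card : ℤ) = ∑ e ∈ P, (if e ∈ F x ∧ e ∈ G xᶜ then (1 : ℤ) else 0) := by
    intro x
    rw [Finset.sum_boole]
    congr 2
    ext e; simp
  simp only [h1, h2]
  exact Finset.sum_comm

omit [Fintype γ] in
/-- The shell weight of a family in terms of `x`-indexed counts:
`Σ_{e ∈ P} shellWeight F G e = Σ_x (#(P ∩ F x ∩ G x) − #(P ∩ F x ∩ G xᶜ))`. [this work] -/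
theorem sum_shellWeight_eq (P : Finset (Finset γ)) (F G : Finset β → Finset (Finset γ)) :
    ∑ e ∈ P, shellWeight F G e = ∑ x : Finset β, (((P ∩ F x ∩ G x).card : ℤ) - (P ∩ F x ∩ G xᶜ).card) := by
  unfold shellWeight
  rw [sum_sub_distrib, sum_sub_distrib, sum_card_idxSet_inter, sum_card_idxSet_inter_refl]

/-- The shell weight of the antipodal image: `Σ_{e ∈ refl P} shellWeight F G e = Σ_x (#(P ∩ refl (F x) ∩ refl (G x)) − #(P ∩ refl (F x) ∩ refl (G xᶜ)))`
— the `D3`-demand minus the `T4`-supply of the certificate language. [this work] -/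
theorem sum_refl_shellWeight_eq (P : Finset (Finset γ)) (F G : Finset β → Finset (Finset γ)) :
    ∑ e ∈ refl P, shellWeight F G e
      = ∑ x : Finset β, (((P ∩ refl (F x) ∩ refl (G x)).card : ℤ) - (P ∩ refl (F x) ∩ refl (G xᶜ)).card) := by
  rw [sum_shellWeight_eq]
  refine Finset.sum_congr rfl fun x _ => ?_
  rw [card_refl_inter_inter, card_refl_inter_inter]

/-! ### The normal form -/

/-- **Kleitman–shell normal form of `TRI_W(a)`** (every index cube, every cube, no hypothesis on `P, F, G`):
`triW P F G = kleitmanPart P F G + 2·Σ_{e ∈ P} shellWeight F G e − Σ_{e ∈ refl P} shellWeight F G e`. [this work] -/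
theorem triW_eq_shell (P : Finset (Finset γ)) (F G : Finset β → Finset (Finset γ)) :
    triW P F G = kleitmanPart P F G + 2 * ∑ e ∈ P, shellWeight F G e - ∑ e ∈ refl P, shellWeight F G e := by
  rw [sum_shellWeight_eq, sum_refl_shellWeight_eq]
  -- the two re-indexings `x ↦ xᶜ`
  have h1 : ∑ x : Finset β, ((P ∩ G x ∩ F xᶜ).card : ℤ) = ∑ x : Finset β, ((P ∩ F x ∩ G xᶜ).card : ℤ) := by
    refine Fintype.sum_equiv (complEquiv β) _ _ (fun x => ?_)
    show ((P ∩ G x ∩ F xᶜ).card : ℤ) = ((P ∩ F xᶜ ∩ G xᶜᶜ).card : ℤ)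
    rw [compl_compl, inter_assoc, inter_comm (G x), ← inter_assoc]
  have h2 : ∑ x : Finset β, ((P ∩ G x ∩ refl (F xᶜ)).card : ℤ)
      = ∑ x : Finset β, ((P ∩ refl (F x) ∩ G xᶜ).card : ℤ) := by
    refine Fintype.sum_equiv (complEquiv β) _ _ (fun x => ?_)
    show ((P ∩ G x ∩ refl (F xᶜ)).card : ℤ) = ((P ∩ refl (F xᶜ) ∩ G xᶜᶜ).card : ℤ)
    rw [compl_compl, inter_assoc, inter_comm (G x), ← inter_assoc]
  -- per-index bookkeeping: the normal-form summand minus `triWTerm` is a difference of the re-indexed terms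
  have hx : ∀ x : Finset β,
      ((((P ∩ F x ∩ G xᶜ).card : ℤ) - (P ∩ F x ∩ refl (G xᶜ)).card)
        + (((P ∩ G x ∩ F xᶜ).card : ℤ) - (P ∩ G x ∩ refl (F xᶜ)).card))
      + 2 * (((P ∩ F x ∩ G x).card : ℤ) - (P ∩ F x ∩ G xᶜ).card)
      - (((P ∩ refl (F x) ∩ refl (G x)).card : ℤ) - (P ∩ refl (F x) ∩ refl (G xᶜ)).card)
      = triWTerm P F G x + (((P ∩ G x ∩ F xᶜ).card : ℤ) - (P ∩ F x ∩ G xᶜ).card)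
          - (((P ∩ G x ∩ refl (F xᶜ)).card : ℤ) - (P ∩ refl (F x) ∩ G xᶜ).card) := by
    intro x
    unfold triWTerm
    ring
  unfold triW kleitmanPart
  rw [Finset.mul_sum, ← sum_add_distrib, ← sum_sub_distrib, Finset.sum_congr rfl (fun x _ => hx x),
    sum_sub_distrib, sum_add_distrib, sum_sub_distrib, sum_sub_distrib, h1, h2]
  ring

/-! ### Consequences -/

/-- **`triW` is at least the shell deficit**: for up-sets `P, F x, G x`,
`2·Σ_{e ∈ P} shellWeight F G e − Σ_{e ∈ refl P} shellWeight F G e ≤ triW P F G`. [this work] -/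
theorem triW_ge_shell (P : Finset (Finset γ)) (F G : Finset β → Finset (Finset γ))
    (hP : IsUpperSet (P : Set (Finset γ))) (hF : ∀ x, IsUpperSet (F x : Set (Finset γ)))
    (hG : ∀ x, IsUpperSet (G x : Set (Finset γ))) :
    2 * ∑ e ∈ P, shellWeight F G e - ∑ e ∈ refl P, shellWeight F G e ≤ triW P F G := by
  rw [triW_eq_shell]
  have := kleitmanPart_nonneg P F G hP hF hG
  linarith

/-- **The self-dual stratum of `TriWIneq`, every `a`**: if the up-set `P` contains its antipodal image (`refl P ⊆ P`), then
`0 ≤ triW P F G` for all monotone families of up-sets `F, G` over any index cube.  Proof: the Kleitman part is `≥ 0`, the shell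
weights are `≥ 0` pointwise, and `Σ_{refl P} c ≤ Σ_P c ≤ 2·Σ_P c`. [this work] -/
theorem triW_nonneg_of_refl_subset (P : Finset (Finset γ)) (F G : Finset β → Finset (Finset γ))
    (hP : IsUpperSet (P : Set (Finset γ))) (hF : ∀ x, IsUpperSet (F x : Set (Finset γ)))
    (hG : ∀ x, IsUpperSet (G x : Set (Finset γ))) (hFm : Monotone F) (hGm : Monotone G)
    (hrefl : refl P ⊆ P) : 0 ≤ triW P F G := by
  have hle : ∑ e ∈ refl P, shellWeight F G e ≤ ∑ e ∈ P, shellWeight F G e :=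
    sum_le_sum_of_subset_of_nonneg hrefl (fun e _ _ => shellWeight_nonneg hFm hGm e)
  have hnn : 0 ≤ ∑ e ∈ P, shellWeight F G e := sum_nonneg fun e _ => shellWeight_nonneg hFm hGm e
  have h := triW_ge_shell P F G hP hF hG
  linarith

/-- The case `P = univ` (all of the cube): `0 ≤ triW univ F G` for monotone families of up-sets, every `a`. [this work] -/
theorem triW_univ_nonneg (F G : Finset β → Finset (Finset γ))
    (hF : ∀ x, IsUpperSet (F x : Set (Finset γ))) (hG : ∀ x, IsUpperSet (G x : Set (Finset γ)))
    (hFm : Monotone F) (hGm : Monotone G) : 0 ≤ triW (univ : Finset (Finset γ)) F G :=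
  triW_nonneg_of_refl_subset univ F G (by rw [coe_univ]; exact isUpperSet_univ) hF hG hFm hGm (subset_univ _)

end FiveUpSet

end Summit.CriticalPhenomena.PercolationContinuityZ3.Theorems
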